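import Summits.CriticalPhenomena.CardyFormulaZ2.Theorems.CardyUniqueLimitCardyRigidityMartingaleOfDataContinuity
import Literature.Probability.RandomPlanarGeometry.ObservableDiscretePassageAE
import Literature.Probability.Process.NaturalFiltrationMartingale
import Literature.Probability.Process.ExitTimeCleanLevels
import Literature.Probability.Process.PathSpaceBorel
import Literature.Probability.RandomPlanarGeometry.LoewnerRealFlowGapAntitone
import Literature.Probability.RandomPlanarGeometry.SLETraceApproximation
import HarnessLib

/-!
# Passage to the continuum crossing martingales (stub `stub_martingaleOfData`, line `crossing-martingale`, crux `CardyRigidity`)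

Closes the registered stub `stub_martingaleOfData` of the skeleton
`Cruxes/CardyRigidity/Lines/crossing_martingale.lean` (v5) of crux `CardyRigidity`
(stmt-CriticalPhenomena-0746; vocabulary of `Theorems/CardyUniqueLimitCardyRigidityDefs.lean`):
the PASSAGE of the crossing-martingale property to a scaling limit, pure measure theory in the
shape of the tree's FK-Ising template `LatticeModels.exists_cylinderIdentityData_of_limitData`.

* `MartingaleOfData.martingale_crossingObs_natural_of_discreteData` — ONE LEVEL: a limit process
  `W` (strongly measurable coordinates, continuous paths, `W 0 = 0`) on a probability space,
  continuous-path processes `V k → W` in distribution on `C([0,∞), ℝ)`, a kernel `g` continuous on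
  `(0,1)`, admissible data `(x; m, M, d)` at which `μ`-a.e. path of `W` has clean level exits, and
  discrete martingale data approximating the level-stopped crossing observable of the canonical
  process at the paths of `V k` (the hypothesis `hD` of
  `Loewner.integral_cylinder_eq_zero_of_discreteMartingales_of_ae_continuousAt`, bounds `1`) ⟹
  `crossingObs g W x m M d` is a martingale in the natural filtration of `W`.  Proof: clamp the
  kernel and clip the starts (`…MartingaleOfDataPath.lean`: a functional measurable in the path,
  continuous in time along every path, bounded, equal to the data functional at paths started in
  `(-δ, δ)`; the other discrete paths form a vanishing bad event, `tendsto_measureReal_le_abs_start`);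
  a.e. joint continuity at the limit paths (`continuousAt_crossingObs_cutStart`); the AE passage
  theorem; monotone class (`Process.martingale_natural_of_integral_cylinder`, adaptedness from
  `FarField.stronglyMeasurable_etaProc_stopped`).
* `stub_martingaleOfData` — the registered signature: sign-reversed driver `-W` (natural filtration
  = that of `W`), sign-reversed discrete drivers `-V k → -W`; GOOD inner levels (a.s. clean exits off
  countably many levels, `Process.exists_countable_forall_ae_clean(_left)`), the one-level passage at
  each of them, and the level extension `IsCrossingMartingaleFamily.of_innerLevels`.
-/

noncomputable section

open MeasureTheory Filter Set Topology
open scoped NNReal ENNReal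
open Literature.Probability.RandomPlanarGeometry
open Literature.Probability.Process

namespace Summit.CriticalPhenomena.CardyFormulaZ2.Cruxes.CardyRigidity.CrossingMartingale

namespace MartingaleOfData

/-! ### Passage at one level with almost surely clean exits -/

section OneLevel

variable [MeasurableSpace C(ℝ≥0, ℝ)] [BorelSpace C(ℝ≥0, ℝ)]
  {x : Fin 3 → ℝ} {m M d : ℝ}
  {Ω : Type*} {mΩ : MeasurableSpace Ω} {μ : Measure Ω} [IsProbabilityMeasure μ]
  {W : Ω → ℝ≥0 → ℝ}
  {Ω' : Type*} {mΩ' : MeasurableSpace Ω'} {P : Measure Ω'} [IsProbabilityMeasure P]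
  {V : ℕ → ℝ≥0 → Ω' → ℝ}

/-- **Passage of the crossing-martingale property at one level** (see the module docstring).
[cite: CamiaNewman2007, §5] [cite: CDHKSCRAS2014, §3] -/
theorem martingale_crossingObs_natural_of_discreteData
    (hWm : ∀ t, StronglyMeasurable fun ω ↦ W ω t) (hWc : ∀ ω, Continuous (W ω))
    (hW0 : ∀ ω, W ω 0 = 0) (hVc : ∀ k ω, Continuous (V k · ω))
    (hlaw : TendstoInDistribution (fun k ω ↦ (⟨fun u ↦ V k u ω, hVc k ω⟩ : C(ℝ≥0, ℝ))) atTop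
      (fun ω ↦ (⟨fun u ↦ W ω u, hWc ω⟩ : C(ℝ≥0, ℝ))) (fun _ ↦ P) μ)
    {g : ℝ → ℝ} (hg : ContinuousOn g (Ioo 0 1)) (h : AdmissibleLevels x m M d)
    (hclean : ∀ᵐ ω ∂μ,
      (∀ T : ℝ≥0, levelTime W x m M d ω = T → exitTime (markFlow W (x 0)) m M ω = T →
        ∀ ε : ℝ, 0 < ε → ∃ s : ℝ≥0, T < s ∧ (s : ℝ) < T + ε ∧ markFlow W (x 0) s ω ∉ Icc m M) ∧
      (∀ T : ℝ≥0, levelTime W x m M d ω = T →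
        exitTime (fun t ω ↦ markFlow W (x 1) t ω - markFlow W (x 0) t ω) d (x 2 - x 0 + 1) ω = T →
        ∀ ε : ℝ, 0 < ε → ∃ s : ℝ≥0, T < s ∧ (s : ℝ) < T + ε ∧
          markFlow W (x 1) s ω - markFlow W (x 0) s ω ∉ Icc d (x 2 - x 0 + 1)) ∧
      (∀ T : ℝ≥0, levelTime W x m M d ω = T →
        exitTime (fun t ω ↦ markFlow W (x 2) t ω - markFlow W (x 1) t ω) d (x 2 - x 0 + 1) ω = T →
        ∀ ε : ℝ, 0 < ε → ∃ s : ℝ≥0, T < s ∧ (s : ℝ) < T + ε ∧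
          markFlow W (x 2) s ω - markFlow W (x 1) s ω ∉ Icc d (x 2 - x 0 + 1)))
    (hD : ∀ s t : ℝ≥0, s < t → ∃ ε Δ η : ℕ → ℝ≥0,
      Tendsto ε atTop (𝓝 0) ∧ Tendsto Δ atTop (𝓝 0) ∧ Tendsto η atTop (𝓝 0) ∧
      ∀ k, ∃ (𝒢 : Filtration ℕ mΩ') (F : ℕ → Ω' → ℝ) (σ τ : Ω' → WithTop ℕ)
        (hσ : IsStoppingTime 𝒢 σ) (Mk : ℕ) (bad : Set Ω'),
        IsStoppingTime 𝒢 τ ∧ Martingale F 𝒢 P ∧ σ ≤ τ ∧ (∀ ω, τ ω ≤ Mk) ∧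
        (∀ u, u ≤ s → Measurable[hσ.measurableSpace] (V k u)) ∧
        (∀ᵐ ω ∂P, ‖stoppedValue F σ ω‖ ≤ 1) ∧ (∀ᵐ ω ∂P, ‖stoppedValue F τ ω‖ ≤ 1) ∧
        MeasurableSet bad ∧ P bad ≤ η k ∧
        ∀ᵐ ω ∂P, ω ∉ bad →
          (∃ u ∈ Icc s (s + Δ k), ‖stoppedValue F σ ω -
            crossingObs g (fun (w : C(ℝ≥0, ℝ)) (r : ℝ≥0) ↦ w r) x m M d u
              (⟨fun r ↦ V k r ω, hVc k ω⟩ : C(ℝ≥0, ℝ))‖ ≤ ε k) ∧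
          (∃ u ∈ Icc t (t + Δ k), ‖stoppedValue F τ ω -
            crossingObs g (fun (w : C(ℝ≥0, ℝ)) (r : ℝ≥0) ↦ w r) x m M d u
              (⟨fun r ↦ V k r ω, hVc k ω⟩ : C(ℝ≥0, ℝ))‖ ≤ ε k)) :
    Martingale (crossingObs g W x m M d) (Filtration.natural (fun t ω ↦ W ω t) hWm) μ := by
  -- clamp the kernel, fix the start window
  obtain ⟨ĝ, hĝ, ⟨B, hB⟩, k₁, k₂, hĝg, hboxK⟩ := exists_clamp_kernel (x := x) hg h
  obtain ⟨δ, hδ0, hδm, hδM⟩ : ∃ δ : ℝ, 0 < δ ∧ δ < x 0 - m ∧ δ < M - x 0 := by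
    refine ⟨min (x 0 - m) (M - x 0) / 2, ?_, ?_, ?_⟩
    · have h1 : 0 < x 0 - m := by linarith [h.m_lt]
      have h2 : 0 < M - x 0 := by linarith [h.lt_M]
      positivity
    · have := min_le_left (x 0 - m) (M - x 0); linarith [h.m_lt]
    · have := min_le_right (x 0 - m) (M - x 0); linarith [h.lt_M]
  -- the path functional and its sure regularity
  set N : ℝ≥0 → C(ℝ≥0, ℝ) → ℝ := fun u w ↦ crossingObs ĝ (fun (w : C(ℝ≥0, ℝ)) (r : ℝ≥0) ↦ w r)
    x m M d u (w - ContinuousMap.const ℝ≥0 (w 0 - max (-δ) (min (w 0) δ))) with hN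
  have hNm : ∀ u, Measurable (N u) := fun u ↦ measurable_crossingObs_cutStart hĝ h hδ0.le hδm u
  have hNu : ∀ w, Continuous fun u ↦ N u w := fun w ↦
    continuous_crossingObs_cutStart_time hĝ h hδ0.le hδm hδM w
  have hNC : ∀ u w, ‖N u w‖ ≤ B := fun u w ↦ norm_crossingObs_le_of_bound hB u _
  -- a.e. joint continuity at the limit paths
  have hNae : ∀ᵐ ω ∂μ, ∀ u, ContinuousAt (Function.uncurry N)
      (u, (⟨fun r ↦ W ω r, hWc ω⟩ : C(ℝ≥0, ℝ))) := by
    filter_upwards [hclean] with ω hω u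
    exact continuousAt_crossingObs_cutStart hĝ h hδ0.le hδm hδM (p₀ := ⟨fun r ↦ W ω r, hWc ω⟩)
      (hW0 ω) hω.1 hω.2.1 hω.2.2 u
  -- agreement with the data functional at paths started in `(-δ, δ)`
  have hagree : ∀ w : C(ℝ≥0, ℝ), |w 0| < δ → ∀ u,
      N u w = crossingObs g (fun (w : C(ℝ≥0, ℝ)) (r : ℝ≥0) ↦ w r) x m M d u w := by
    intro w hw u
    have hwin : w 0 ∈ Ioo (x 0 - M) (x 0 - m) := by
      have h1 := abs_lt.1 hw
      constructor <;> linarith [h1.1, h1.2]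
    show crossingObs ĝ (fun (w : C(ℝ≥0, ℝ)) (r : ℝ≥0) ↦ w r) x m M d u
      (w - ContinuousMap.const ℝ≥0 (w 0 - max (-δ) (min (w 0) δ))) = _
    rw [cutStart_of_abs_le hw.le]
    exact crossingObs_eq_of_clamp_pt hĝg hboxK (W := fun (w : C(ℝ≥0, ℝ)) (r : ℝ≥0) ↦ w r) (ω := w)
      w.continuous h hwin u
  -- the limit observable
  have hNW : ∀ t ω, N t (⟨fun r ↦ W ω r, hWc ω⟩ : C(ℝ≥0, ℝ)) = crossingObs ĝ W x m M d t ω := by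
    intro t ω
    show crossingObs ĝ (fun (w : C(ℝ≥0, ℝ)) (r : ℝ≥0) ↦ w r) x m M d t
      ((⟨fun r ↦ W ω r, hWc ω⟩ : C(ℝ≥0, ℝ)) - ContinuousMap.const ℝ≥0
        ((⟨fun r ↦ W ω r, hWc ω⟩ : C(ℝ≥0, ℝ)) 0 -
          max (-δ) (min ((⟨fun r ↦ W ω r, hWc ω⟩ : C(ℝ≥0, ℝ)) 0) δ))) = _
    rw [cutStart_of_abs_le (by show |W ω 0| ≤ δ; rw [hW0 ω, abs_zero]; exact hδ0.le)]
    exact crossingObs_path_eq hWc ĝ x m M d t ω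
  have hEqW : crossingObs ĝ W x m M d = crossingObs g W x m M d := by
    funext t ω
    refine crossingObs_eq_of_clamp_pt hĝg hboxK (hWc ω) h ?_ t
    rw [hW0 ω]
    constructor <;> linarith [h.m_lt, h.lt_M]
  -- `V k 0` is measurable (data at times `0 < 1`)
  have hV0 : ∀ k, Measurable (V k 0) := by
    intro k
    obtain ⟨ε, Δ, η, -, -, -, hDk⟩ := hD 0 1 zero_lt_one
    obtain ⟨𝒢, F, σ, τ, hσ, Mk, bad, -, -, -, -, hVm, -⟩ := hDk k
    exact (hVm 0 le_rfl).mono hσ.measurableSpace_le le_rfl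
  have hstart := tendsto_measureReal_le_abs_start hWc hW0 hVc hlaw hV0 hδ0
  haveI : ∀ k : ℕ, IsProbabilityMeasure ((fun _ : ℕ ↦ P) k) := fun _ ↦ by
    dsimp only; infer_instance
  -- the cylinder identity for `s < t`
  have hcyl : ∀ s t : ℝ≥0, s < t → ∀ (n : ℕ) (S : Fin n → ℝ≥0), (∀ i, S i ≤ s) →
      ∀ ψ : (Fin n → ℝ) → ℝ, Continuous ψ → (∀ v, |ψ v| ≤ 1) →
        ∫ ω, (crossingObs ĝ W x m M d t ω - crossingObs ĝ W x m M d s ω) *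
          ψ (fun i ↦ W ω (S i)) ∂μ = 0 := by
    intro s t hst n S hS ψ hψc hψ1
    obtain ⟨ε, Δ, η, hε, hΔ, hη, hDk⟩ := hD s t hst
    -- enlarged bad events: the discrete paths not started in `(-δ, δ)`
    set η' : ℕ → ℝ≥0 := fun k ↦ η k + (P {ω | δ ≤ |V k 0 ω|}).toNNReal with hη'
    have hη'0 : Tendsto η' atTop (𝓝 0) := by
      have h1 : Tendsto (fun k ↦ (P {ω | δ ≤ |V k 0 ω|}).toNNReal) atTop (𝓝 0) := by
        rw [← NNReal.tendsto_coe]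
        exact hstart
      simpa using hη.add h1
    have key := Loewner.integral_cylinder_eq_zero_of_discreteMartingales_of_ae_continuousAt
      (P := fun _ ↦ P) (W := fun t ω ↦ W ω t) (fun ω ↦ hWc ω) hVc hlaw hNm hNu hNae hNC s t hS
      hψc hψ1 (C' := 1) hε hΔ hη'0 fun k ↦ ?_
    · simpa only [hNW] using key
    obtain ⟨𝒢, F, σ, τ, hσ, Mk, bad, hτ, hF, hστ, hτM, hVm, hbσ, hbτ, hbad, hPbad, happ⟩ := hDk k
    have hSm : MeasurableSet {ω | δ ≤ |V k 0 ω|} :=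
      measurableSet_le measurable_const (continuous_abs.measurable.comp (hV0 k))
    refine ⟨𝒢, F, σ, τ, hσ, Mk, bad ∪ {ω | δ ≤ |V k 0 ω|}, hτ, hF, hστ, hτM, hVm, hbσ, hbτ,
      hbad.union hSm, ?_, ?_⟩
    · calc P (bad ∪ {ω | δ ≤ |V k 0 ω|}) ≤ P bad + P {ω | δ ≤ |V k 0 ω|} := measure_union_le _ _
        _ ≤ (η k : ℝ≥0∞) + ((P {ω | δ ≤ |V k 0 ω|}).toNNReal : ℝ≥0∞) :=
            add_le_add hPbad (ENNReal.coe_toNNReal (measure_ne_top _ _)).ge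
        _ = (η' k : ℝ≥0∞) := by rw [hη', ENNReal.coe_add]
    · filter_upwards [happ] with ω hω hωbad
      have hωb : ω ∉ bad := fun h' ↦ hωbad (Or.inl h')
      have hωs : |V k 0 ω| < δ := not_le.1 fun h' ↦ hωbad (Or.inr h')
      have hw0 : |(⟨fun r ↦ V k r ω, hVc k ω⟩ : C(ℝ≥0, ℝ)) 0| < δ := hωs
      simpa only [hagree _ hw0] using hω hωb
  -- adaptedness and integrability in the natural filtration
  set 𝓕 := Filtration.natural (fun t ω ↦ W ω t) hWm with h𝓕
  have hWad : StronglyAdapted 𝓕 (fun t ω ↦ W ω t) := Filtration.stronglyAdapted_natural _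
  have hXad : StronglyAdapted 𝓕 (crossingObs ĝ W x m M d) := fun t ↦
    hĝ.comp_stronglyMeasurable (FarField.stronglyMeasurable_etaProc_stopped hWad hWc hW0 h t)
  have hXint : ∀ t, Integrable (crossingObs ĝ W x m M d t) μ := fun t ↦
    (integrable_const B).mono' ((hXad t).mono (𝓕.le t)).aestronglyMeasurable
      (ae_of_all _ fun ω ↦ norm_crossingObs_le_of_bound hB t ω)
  rw [← hEqW]
  refine martingale_natural_of_integral_cylinder hWm hXad hXint fun s t hst n S hS ψ hψc hψ1 ↦ ?_
  rcases eq_or_lt_of_le hst with rfl | hlt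
  · simp
  · exact hcyl s t hlt n S hS ψ hψc hψ1

end OneLevel

/-! ### The natural filtration of the sign-reversed process -/

/-- The natural filtration of `-W` is the natural filtration of `W`. [folklore] -/
theorem natural_neg_eq {Ω : Type*} {mΩ : MeasurableSpace Ω} {W : Ω → ℝ≥0 → ℝ}
    (hWm : ∀ t, StronglyMeasurable fun ω ↦ W ω t)
    (hW'm : ∀ t, StronglyMeasurable fun ω ↦ -W ω t) :
    Filtration.natural (fun t ω ↦ -W ω t) hW'm = Filtration.natural (fun t ω ↦ W ω t) hWm := by
  have hcomap : ∀ j : ℝ≥0,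
      MeasurableSpace.comap (fun ω ↦ -W ω j) (inferInstance : MeasurableSpace ℝ) =
        MeasurableSpace.comap (fun ω ↦ W ω j) inferInstance := by
    intro j
    apply le_antisymm
    · rintro s ⟨u, hu, rfl⟩
      exact ⟨Neg.neg ⁻¹' u, measurable_neg hu, rfl⟩
    · rintro s ⟨u, hu, rfl⟩
      refine ⟨Neg.neg ⁻¹' u, measurable_neg hu, ?_⟩
      ext ω
      simp
  refine Filtration.ext (funext fun t ↦ ?_)
  change (⨆ j ≤ t, MeasurableSpace.comap (fun ω ↦ -W ω j) (inferInstance : MeasurableSpace ℝ)) =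
    ⨆ j ≤ t, MeasurableSpace.comap (fun ω ↦ W ω j) (inferInstance : MeasurableSpace ℝ)
  simp only [hcomap]

end MartingaleOfData

/-! ### The registered stub -/

open scoped Literature.Probability.RandomPlanarGeometry.PathBorel

open MartingaleOfData in
/-- STUB A4 — **passage to the continuum crossing martingales** (the shape of
`LatticeModels.exists_cylinderIdentityData_of_limitData`, for the real level-stopped crossing observable).
On a probability space `(Ω, μ)` let `W` have strongly measurable marginals and let `W` and `-W` be regular
drivers for the natural filtration of `W`; let continuous-path processes `V^k` on a probability space
`(Ω', P)` converge in distribution in `C([0,∞), ℝ)` to `W`; and suppose that for a kernel `f` continuous on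
`(0,1)`, every admissible `(x; m, M, d)` and all `s < t` the discrete martingale data of STUB A3 hold for
the level-stopped `f`-crossing observable of the paths of `-V^k`.  Then the level-stopped `f`-crossing
observables of `-W` are martingales for the natural filtration of `W`:
`IsCrossingMartingaleFamily f μ (-W) (natural W)` (a.e.-continuity of the level-stopped functional at
good levels, `Loewner.integral_cylinder_eq_zero_of_discreteMartingales_of_ae_continuousAt`, monotone class,
`IsCrossingMartingaleFamily.of_innerLevels`). [cite: CDHKSCRAS2014, §3] [cite: CamiaNewman2007, §5] -/
theorem stub_martingaleOfData :
    ∀ (f : ℝ → ℝ), ContinuousOn f (Ioo 0 1) →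
    ∀ {Ω : Type} [MeasurableSpace Ω] (μ : Measure Ω) [IsProbabilityMeasure μ]
      (W : Ω → ℝ≥0 → ℝ) (hWm : ∀ t, StronglyMeasurable (fun ω ↦ W ω t))
      (hWc : ∀ ω, Continuous (W ω)),
      IsRegularDriver μ W (Filtration.natural (fun t ω ↦ W ω t) hWm) →
      IsRegularDriver μ (fun ω t ↦ -W ω t) (Filtration.natural (fun t ω ↦ W ω t) hWm) →
    ∀ {Ω' : Type} [MeasurableSpace Ω'] (P : Measure Ω') [IsProbabilityMeasure P]
      (V : ℕ → ℝ≥0 → Ω' → ℝ) (hVc : ∀ k ω, Continuous (V k · ω)),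
      TendstoInDistribution (fun k ω ↦ (⟨fun u ↦ V k u ω, hVc k ω⟩ : C(ℝ≥0, ℝ))) atTop
        (fun ω ↦ (⟨fun u ↦ W ω u, hWc ω⟩ : C(ℝ≥0, ℝ))) (fun _ ↦ P) μ →
      (∀ (x : Fin 3 → ℝ) (m M d : ℝ), AdmissibleLevels x m M d →
        ∀ s t : ℝ≥0, s < t →
        ∃ ε Δ η : ℕ → ℝ≥0, Tendsto ε atTop (𝓝 0) ∧ Tendsto Δ atTop (𝓝 0) ∧
          Tendsto η atTop (𝓝 0) ∧
          ∀ k, ∃ (𝒢 : Filtration ℕ ‹MeasurableSpace Ω'›) (F : ℕ → Ω' → ℝ) (σ τ : Ω' → WithTop ℕ)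
            (hσ : IsStoppingTime 𝒢 σ) (Mk : ℕ) (bad : Set Ω'),
            IsStoppingTime 𝒢 τ ∧ Martingale F 𝒢 P ∧ σ ≤ τ ∧ (∀ ω, τ ω ≤ Mk) ∧
            (∀ u, u ≤ s → Measurable[hσ.measurableSpace] fun ω ↦ -V k u ω) ∧
            (∀ᵐ ω ∂P, ‖stoppedValue F σ ω‖ ≤ 1) ∧ (∀ᵐ ω ∂P, ‖stoppedValue F τ ω‖ ≤ 1) ∧
            MeasurableSet bad ∧ P bad ≤ η k ∧
            ∀ᵐ ω ∂P, ω ∉ bad →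
              (∃ u ∈ Icc s (s + Δ k), ‖stoppedValue F σ ω -
                crossingObs f (fun (w : C(ℝ≥0, ℝ)) (r : ℝ≥0) ↦ w r) x m M d u
                  ⟨fun r ↦ -V k r ω, (hVc k ω).neg⟩‖ ≤ ε k) ∧
              (∃ u ∈ Icc t (t + Δ k), ‖stoppedValue F τ ω -
                crossingObs f (fun (w : C(ℝ≥0, ℝ)) (r : ℝ≥0) ↦ w r) x m M d u
                  ⟨fun r ↦ -V k r ω, (hVc k ω).neg⟩‖ ≤ ε k)) →
      IsCrossingMartingaleFamily f μ (fun ω t ↦ -W ω t)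
        (Filtration.natural (fun t ω ↦ W ω t) hWm) := by
  intro f hf Ω _ μ _ W hWm hWc _ hreg' Ω' _ P _ V hVc hlaw hdata
  -- the sign-reversed driver `W' = -W` and its natural filtration
  have hW'c : ∀ ω, Continuous fun t ↦ -W ω t := hreg'.2.1
  have hW'0 : ∀ ω, -W ω 0 = 0 := hreg'.2.2.1
  have hW'm : ∀ t, StronglyMeasurable fun ω ↦ -W ω t := fun t ↦ (hWm t).neg
  rw [← natural_neg_eq hWm hW'm]
  have hW'ad : StronglyAdapted (Filtration.natural (fun t ω ↦ -W ω t) hW'm) (fun t ω ↦ -W ω t) :=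
    Filtration.stronglyAdapted_natural _
  -- the sign-reversed discrete drivers converge in distribution to `W'`
  have hV'c : ∀ k ω, Continuous fun u ↦ -V k u ω := fun k ω ↦ (hVc k ω).neg
  have hlaw' : TendstoInDistribution (fun k ω ↦ (⟨fun u ↦ -V k u ω, hV'c k ω⟩ : C(ℝ≥0, ℝ))) atTop
      (fun ω ↦ (⟨fun u ↦ -W ω u, hW'c ω⟩ : C(ℝ≥0, ℝ))) (fun _ ↦ P) μ :=
    hlaw.continuous_comp (continuous_neg (G := C(ℝ≥0, ℝ)))
  -- reduce to good inner levels
  refine IsCrossingMartingaleFamily.of_innerLevels (W := fun ω t ↦ -W ω t) hf hW'c hW'0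
    fun x m M d h ↦ ?_
  have hxpos : ∀ i, 0 < x i := fun i ↦ h.pos.trans_le (h.strictMono.monotone (Fin.zero_le i))
  have hx01 : x 0 < x 1 := h.strictMono (by decide)
  have hx12 : x 1 < x 2 := h.strictMono (by decide)
  set G : ℝ := x 2 - x 0 + 1 with hG
  -- the coordinate paths of `W'` and their laws
  have hcW := fun ω i ↦ continuous_markFlow_pt (W := fun ω t ↦ -W ω t) (ω := ω) (hW'c ω) (x i)
  set P0 : Ω → C(ℝ≥0, ℝ) := fun ω ↦ ⟨fun s ↦ markFlow (fun ω t ↦ -W ω t) (x 0) s ω, hcW ω 0⟩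
    with hP0
  set P1 : Ω → C(ℝ≥0, ℝ) := fun ω ↦ ⟨fun s ↦ markFlow (fun ω t ↦ -W ω t) (x 1) s ω -
    markFlow (fun ω t ↦ -W ω t) (x 0) s ω, (hcW ω 1).sub (hcW ω 0)⟩ with hP1
  set P2 : Ω → C(ℝ≥0, ℝ) := fun ω ↦ ⟨fun s ↦ markFlow (fun ω t ↦ -W ω t) (x 2) s ω -
    markFlow (fun ω t ↦ -W ω t) (x 1) s ω, (hcW ω 2).sub (hcW ω 1)⟩ with hP2
  have hmf : ∀ i (r : ℝ≥0), Measurable fun ω ↦ markFlow (fun ω t ↦ -W ω t) (x i) r ω := by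
    intro i r
    have had := FarField.adapted_markFlow hW'ad hW'c hW'0 (hxpos i) r
    exact had.mono ((Filtration.natural _ hW'm).le r) le_rfl
  have hmeas : ∀ {Φ : Ω → C(ℝ≥0, ℝ)}, (∀ r, Measurable fun ω ↦ Φ ω r) → Measurable Φ :=
    fun hΦ ↦ measurable_continuousMap_of_eval hΦ
  have hP0m : Measurable P0 := hmeas fun r ↦ hmf 0 r
  have hP1m : Measurable P1 := hmeas fun r ↦ (hmf 1 r).sub (hmf 0 r)
  have hP2m : Measurable P2 := hmeas fun r ↦ (hmf 2 r).sub (hmf 1 r)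
  haveI : IsProbabilityMeasure (μ.map P0) := Measure.isProbabilityMeasure_map hP0m.aemeasurable
  haveI : IsProbabilityMeasure (μ.map P1) := Measure.isProbabilityMeasure_map hP1m.aemeasurable
  haveI : IsProbabilityMeasure (μ.map P2) := Measure.isProbabilityMeasure_map hP2m.aemeasurable
  obtain ⟨A0, B0, hA0, hB0, hclean0⟩ := exists_countable_forall_ae_clean (μ.map P0)
  obtain ⟨A1, hA1, hclean1⟩ := exists_countable_forall_ae_clean_left (μ.map P1)
  obtain ⟨A2, hA2, hclean2⟩ := exists_countable_forall_ae_clean_left (μ.map P2)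
  -- inner levels avoiding the countable bad sets
  obtain ⟨mk, hmk_anti, hmk_mem, hmk_good, hmk_lim⟩ := exists_antitone_seq_notMem hA0 h.m_lt
  obtain ⟨Mk, hMk_mono, hMk_mem, hMk_good, hMk_lim⟩ := exists_monotone_seq_notMem hB0 h.lt_M
  have hdlt : d < min (x 1 - x 0) (x 2 - x 1) := lt_min h.d_lt₁ h.d_lt₂
  obtain ⟨dk, hdk_anti, hdk_mem, hdk_good, hdk_lim⟩ :=
    exists_antitone_seq_notMem (hA1.union hA2) hdlt
  have hadm : ∀ k, AdmissibleLevels x (mk k) (Mk k) (dk k) := fun k ↦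
    { strictMono := h.strictMono
      pos := h.pos
      m_pos := h.m_pos.trans (hmk_mem k).1
      m_lt := (hmk_mem k).2
      lt_M := (hMk_mem k).1
      d_pos := h.d_pos.trans (hdk_mem k).1
      d_lt₁ := (hdk_mem k).2.trans_le (min_le_left _ _)
      d_lt₂ := (hdk_mem k).2.trans_le (min_le_right _ _) }
  refine ⟨mk, Mk, dk, hmk_anti, hMk_mono, hdk_anti, hmk_lim, hMk_lim, hdk_lim, fun k ↦
    ⟨(hmk_mem k).1.le, (hMk_mem k).2.le, (hdk_mem k).1.le, hadm k, ?_⟩⟩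
  have hk := hadm k
  refine martingale_crossingObs_natural_of_discreteData (V := fun k u ω ↦ -V k u ω) hW'm hW'c hW'0
    hV'c hlaw' hf hk ?_ (hdata x (mk k) (Mk k) (dk k) hk)
  -- a.e. clean exits at the good level `k`
  have hc0 := ae_of_ae_map hP0m.aemeasurable (hclean0 (mk k) (hmk_good k) (Mk k) (hMk_good k))
  have hc1 := ae_of_ae_map hP1m.aemeasurable (hclean1 (dk k) (fun hmem ↦ hdk_good k (Or.inl hmem)) G)
  have hc2 := ae_of_ae_map hP2m.aemeasurable (hclean2 (dk k) (fun hmem ↦ hdk_good k (Or.inr hmem)) G)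
  filter_upwards [hc0, hc1, hc2] with ω hω0 hω1 hω2
  have hwin : (fun ω t ↦ -W ω t) ω 0 ∈ Ioo (x 0 - Mk k) (x 0 - mk k) := by
    show -W ω 0 ∈ Ioo (x 0 - Mk k) (x 0 - mk k)
    rw [hW'0 ω]
    constructor <;> linarith [hk.m_lt, hk.lt_M]
  have hz : ∀ i, markFlow (fun ω t ↦ -W ω t) (x i) 0 ω = x i := fun i ↦ by
    rw [markFlow_zero_pt (W := fun ω t ↦ -W ω t) (hW'c ω) (start_lt_mark hk hwin.2 i).ne']
    show x i - -W ω 0 = x i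
    rw [hW'0 ω, sub_zero]
  have hstart0 : (P0 ω) 0 ∈ Ioo (mk k) (Mk k) := by
    show markFlow (fun ω t ↦ -W ω t) (x 0) 0 ω ∈ Ioo (mk k) (Mk k)
    rw [hz 0]; exact ⟨hk.m_lt, hk.lt_M⟩
  have hstart1 : (P1 ω) 0 ∈ Ioo (dk k) G := by
    show markFlow (fun ω t ↦ -W ω t) (x 1) 0 ω - markFlow (fun ω t ↦ -W ω t) (x 0) 0 ω ∈ Ioo (dk k) G
    rw [hz 1, hz 0]; exact ⟨hk.d_lt₁, by rw [hG]; linarith⟩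
  have hstart2 : (P2 ω) 0 ∈ Ioo (dk k) G := by
    show markFlow (fun ω t ↦ -W ω t) (x 2) 0 ω - markFlow (fun ω t ↦ -W ω t) (x 1) 0 ω ∈ Ioo (dk k) G
    rw [hz 2, hz 1]; exact ⟨hk.d_lt₂, by rw [hG]; linarith⟩
  -- a gap never exceeds its initial value before the level time
  have hgap_le : ∀ (i j : Fin 3), i < j → ∀ (s : ℝ≥0),
      (s : WithTop ℝ≥0) ≤ levelTime (fun ω t ↦ -W ω t) x (mk k) (Mk k) (dk k) ω →
      markFlow (fun ω t ↦ -W ω t) (x j) s ω - markFlow (fun ω t ↦ -W ω t) (x i) s ω ≤ x j - x i := by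
    intro i j hij s hs
    obtain ⟨h0, h01, h12⟩ := marks_pos_pt (W := fun ω t ↦ -W ω t) (hW'c ω) hk hwin hs
    have hposi : 0 < markFlow (fun ω t ↦ -W ω t) (x i) s ω := by
      fin_cases i
      · exact h0
      · exact h0.trans h01
      · exact (h0.trans h01).trans h12
    have halive : (s : WithTop ℝ≥0) < Loewner.swallowingTime (fun u ↦ -W ω u) (x i) :=
      Loewner.coe_lt_swallowingTime_of_realFlowStop_ne_zero hposi.ne'
    have hyi : (fun u ↦ -W ω u) 0 < x i := by
      show -W ω 0 < x i
      rw [hW'0 ω]; exact hxpos i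
    exact Loewner.realFlowStop_sub_realFlowStop_le_sub (hW'c ω) hyi (h.strictMono hij) halive
  refine ⟨fun T _ hT ↦ hω0 hstart0 T hT, fun T hρ hT ↦ hω1 hstart1 T hT ?_, fun T hρ hT ↦
    hω2 hstart2 T hT ?_⟩
  · rcases apply_eq_or_eq_of_exitTime_eq_coe (u := fun t (q : C(ℝ≥0, ℝ)) ↦ q t) (ω := P1 ω)
      (P1 ω).continuous hstart1 hT with h1 | h1
    · exact h1
    · exfalso
      have hle := hgap_le 0 1 (by decide) T (by rw [hρ])
      have : (P1 ω) T = markFlow (fun ω t ↦ -W ω t) (x 1) T ω -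
          markFlow (fun ω t ↦ -W ω t) (x 0) T ω := rfl
      rw [this] at h1
      rw [h1, hG] at hle
      linarith
  · rcases apply_eq_or_eq_of_exitTime_eq_coe (u := fun t (q : C(ℝ≥0, ℝ)) ↦ q t) (ω := P2 ω)
      (P2 ω).continuous hstart2 hT with h1 | h1
    · exact h1
    · exfalso
      have hle := hgap_le 1 2 (by decide) T (by rw [hρ])
      have : (P2 ω) T = markFlow (fun ω t ↦ -W ω t) (x 2) T ω -
          markFlow (fun ω t ↦ -W ω t) (x 1) T ω := rfl
      rw [this] at h1
      rw [h1, hG] at hle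
      linarith

end Summit.CriticalPhenomena.CardyFormulaZ2.Cruxes.CardyRigidity.CrossingMartingale

end
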